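import Summits.CriticalPhenomena.PercolationContinuityZ3.Theorems.PercNearOneGluingNoHeavyQuantDeepLowsGiants
import Summits.CriticalPhenomena.PercolationContinuityZ3.Theorems.PercNearOneGluingNoHeavyQuantGatedConvSplit
import HarnessLib

/-!
# QUANT lane R8, T-DEC: `SingleGateConvClosed` AT THE DOMINANT LAYERS — ONE HEAVY FACTOR SUFFICES (q < 1 companion of `…QuantConvDominant`)

builds on p205010 (kernel theorem, internal audit signed; external expert review pending)

Support file (`--supports stmt-CriticalPhenomena-4575`), QUANT lane seat prim-quant-arm-2 (gen 34), rung R8 of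
`run/shared/lean/prim/quant/LADDER.md`.  Theorems only (no definitions), standard axioms, no sorries.  Uses this seat's `…QuantDeepLowsGiants`
(`deepLows_le_giants`, `tail_ge_of_decAt_all`, `conv_tail_eq`, `sum_ite_TP`), typer g22's `HDECAtT` (`…QuantSliceHeavy`), `gate` / `lconv` (`…QuantSDEC`).

WHAT.  `0 < y < 1`, `y ≤ q ≤ 1`; `μ₁`, `μ₂` probability laws on `{0..M₁}`, `{0..M₂}` (means `T₁`, `T₂`); `gate_q μ₁` top-affordable
(`y·M₁ ≤ q·T₁`) and DEC(j′) at every `j′ < M₁` (ANY data — the hypothesis of `SingleGateConvClosed` on `μ₁`); `gate_q μ₂` with a HEAVY datum at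
the layer `j` and target `q·T₂`; `2j < q(T₁ + T₂)`.  THEN **`y ≤ Σ_{h > j} gate_q(μ₁ ∗ μ₂) h`** (`gateConv_tail_ge_of_hdecAtT`), i.e. the conclusion of
`SingleGateConvClosed` at the dominant layer `j` (`gateConv_decAt_of_hdecAtT_dominant`, by the far split); with BOTH gated factors heavy-DEC at
every layer below their tops the gated convolution is DEC at EVERY dominant layer (`gateConv_decAt_dominant_of_hdec`).
PROOF.  `P{> j} = Σ_r λ_r·W_r − (1−q)·θ/q` over the heavy datum `gate_q μ₂ = Σ_r λ_r·{lo_r, hi_r; g_r}`, with `W_r = (1−g)Ψ(lo) + gΨ(hi)`,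
BARE tails `Ψ(s) = μ₁{i : i + s ≥ j+1}` (`= 1` for `s > j`, `= gate_q μ₁{> j−s}/q` for `s ≤ j`) and `θ = gate_q μ₁{> j}` — the `(1−q)`-part of
the zero atom of `gate_q μ₂` is not an atom of `μ₂` (`gateConv_tail_eq_pieces`); also `P{> j} ≥ θ` (`gateConv_tail_ge_theta`).  Piece values: an
atom above `j` is worth `1`; a self-sufficient point `b ≤ j` is worth `Ψ(b) ≥ y/q` (row of `gate_q μ₁` at the dominant layer `j − b`); a heavy
credit pair `{lo < hi ≤ j}` is worth `≥ y/q` (`deepLows_le_giants` at `i = j−lo`, `i′ = j−hi`: `i + i′ < qT₁` since `lo + hi ≥ qT₂`); a giant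
pair `{lo ≤ j < hi; g ≥ y}` is worth `g + (1−g)Ψ(lo) ≥ g + (1−g)·θ/q` (`≥ g + (1−g)y/q` if `lo` is self-sufficient).  So every piece has
`W_r ≥ y + u_r + v_r·θ/q`, `u_r, v_r ≥ 0`, `u_r + v_r·y/q ≥ (1−q)y/q` (`q ≥ y`); summing, `P{> j} − y ≥ U + (V − (1−q))·θ/q`, `U ≥ 0`,
`U + (V − (1−q))·y/q ≥ 0` — nonnegative if `V ≥ 1−q`, else affine-decreasing in `θ` and nonnegative at `θ = y`, while `θ > y` gives
`P{> j} ≥ θ` directly.  No pooling, no routing.  The LIGHT credit pairs of `gate_q μ₂` at layer `j` are what this cannot pay for; the full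
dominant rows hold in every exact census of `SingleGateConvClosed` (this seat's kit j170273: 144 000 boundary-pushed instances / 0, all layers) —
evidence only.  HONEST STATUS: a partial result (dominant layers, one heavy factor); `SingleGateConvClosed`, `GateMove`, `ConvClosedT`,
`SDECConvClosed`, `TreeDEC`, `FarTreeRow` remain OPEN; the RATE class log\* and the honest sentence of `run/shared/lean/prim/quant/README.md` unchanged.

* `LawDec.gateConv_tail_eq_pieces`, `LawDec.gateConv_tail_ge_theta`; **`LawDec.gateConv_tail_ge_of_hdecAtT`**,
  `LawDec.gateConv_decAt_of_hdecAtT_dominant`, **`LawDec.gateConv_decAt_dominant_of_hdec`**.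

[this work]; heavy world: prim-quant-stmt g22; single-gate binder: prim-quant-lead g28 (this lane).  Nothing here is cited as a published result.
The gluing rows served [cite: KozmaNitzan2024, Conjecture 3 (p. 15)]; product measure [cite: Grimmett1999, §1.3 p. 10].
-/

noncomputable section

namespace Summit.CriticalPhenomena.PercolationContinuityZ3.Theorems

namespace Quant

open Finset

/-- the two-point law `{lo, hi; g}` (as in `…QuantLawDEC`) -/
local notation3 "TP[" lo ", " hi ", " g ", " h "]" =>
  (g : ℝ) * (if (h : ℕ) = (hi : ℕ) then (1 : ℝ) else 0) + (1 - (g : ℝ)) * (if (h : ℕ) = (lo : ℕ) then (1 : ℝ) else 0)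

namespace LawDec

/-! ### The tail of the gated convolution over a datum of the second gated factor -/

/-- **the tail of the gated convolution over a datum of `gate_q μ₂ = Σ_r λ_r·TP_r`**:
`Σ_{j < h ≤ M₁+M₂} gate (lconv μ₁ μ₂) q h = Σ_r λ_r·(g_r·Ψ(hi_r) + (1−g_r)·Ψ(lo_r)) − (1−q)·Ψ(0)`, `Ψ(s) = Σ_{i ≤ M₁} μ₁ i·[j+1 ≤ i+s]`. [this work] -/
theorem gateConv_tail_eq_pieces {ρ : Type} [Fintype ρ] (M₁ M₂ j : ℕ) (μ₁ μ₂ : ℕ → ℝ) (q : ℝ) (lam g : ρ → ℝ) (lo hi : ρ → ℕ)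
    (hlohi : ∀ r, lo r ≤ hi r) (hhi : ∀ r, hi r ≤ M₂) (hν₂ : ∀ k, gate μ₂ q k = ∑ r, lam r * TP[lo r, hi r, g r, k]) :
    ∑ h ∈ Finset.Ico (j + 1) (M₁ + M₂ + 1), gate (lconv M₁ M₂ μ₁ μ₂) q h
      = ∑ r, lam r * (g r * ∑ i ∈ Finset.range (M₁ + 1), μ₁ i * (if j + 1 ≤ i + hi r then (1 : ℝ) else 0)
          + (1 - g r) * ∑ i ∈ Finset.range (M₁ + 1), μ₁ i * (if j + 1 ≤ i + lo r then (1 : ℝ) else 0))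
        - (1 - q) * ∑ i ∈ Finset.range (M₁ + 1), μ₁ i * (if j + 1 ≤ i then (1 : ℝ) else 0) := by
  classical
  -- the gate does not touch the atoms above `j ≥ 0`
  have hgate : ∀ h ∈ Finset.Ico (j + 1) (M₁ + M₂ + 1), gate (lconv M₁ M₂ μ₁ μ₂) q h = q * lconv M₁ M₂ μ₁ μ₂ h := by
    intro h hh
    rw [gate_apply, if_neg (by have := (Finset.mem_Ico.1 hh).1; omega)]; ring
  rw [Finset.sum_congr rfl hgate, ← Finset.mul_sum, conv_tail_eq]
  -- `q·μ₂ k = gate μ₂ q k − (1−q)·[k = 0]`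
  have hqμ : ∀ k, q * μ₂ k = (∑ r, lam r * TP[lo r, hi r, g r, k]) - (1 - q) * (if k = 0 then (1 : ℝ) else 0) := by
    intro k; rw [← hν₂ k, gate_apply]; ring
  -- row by row
  have hrow : ∀ i ∈ Finset.range (M₁ + 1),
      q * ∑ k ∈ Finset.range (M₂ + 1), (if j + 1 ≤ i + k then μ₁ i * μ₂ k else 0)
        = (∑ r, lam r * (μ₁ i * (g r * (if j + 1 ≤ i + hi r then (1 : ℝ) else 0)
            + (1 - g r) * (if j + 1 ≤ i + lo r then (1 : ℝ) else 0))))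
          - (1 - q) * (μ₁ i * (if j + 1 ≤ i then (1 : ℝ) else 0)) := by
    intro i _
    have e1 : q * ∑ k ∈ Finset.range (M₂ + 1), (if j + 1 ≤ i + k then μ₁ i * μ₂ k else 0)
        = ∑ k ∈ Finset.range (M₂ + 1), (if j + 1 ≤ i + k then μ₁ i * (q * μ₂ k) else 0) := by
      rw [Finset.mul_sum]
      exact Finset.sum_congr rfl fun k _ => by split_ifs <;> ring
    rw [e1]
    have e2 : ∀ k, (if j + 1 ≤ i + k then μ₁ i * (q * μ₂ k) else 0)
        = (∑ r, (if j + 1 ≤ i + k then (μ₁ i * lam r) * TP[lo r, hi r, g r, k] else 0))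
          - (1 - q) * μ₁ i * (if j + 1 ≤ i + k then (if k = 0 then (1 : ℝ) else 0) else 0) := by
      intro k
      by_cases hjk : j + 1 ≤ i + k
      · simp only [if_pos hjk]
        rw [hqμ k, mul_sub, Finset.mul_sum]
        congr 1
        · exact Finset.sum_congr rfl fun r _ => by ring
        · ring
      · simp only [if_neg hjk, Finset.sum_const_zero]; ring
    rw [Finset.sum_congr rfl (fun k _ => e2 k), Finset.sum_sub_distrib, Finset.sum_comm]
    congr 1
    · refine Finset.sum_congr rfl fun r _ => ?_
      have e3 : ∑ k ∈ Finset.range (M₂ + 1), (if j + 1 ≤ i + k then (μ₁ i * lam r) * TP[lo r, hi r, g r, k] else 0)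
          = (μ₁ i * lam r) * ∑ k ∈ Finset.range (M₂ + 1), (if j + 1 ≤ i + k then TP[lo r, hi r, g r, k] else 0) := by
        rw [Finset.mul_sum]
        exact Finset.sum_congr rfl fun k _ => by split_ifs <;> ring
      rw [e3, sum_ite_TP M₂ j i (lo r) (hi r) (g r) ((hlohi r).trans (hhi r)) (hhi r)]
      ring
    · have e4 : ∀ k, (if j + 1 ≤ i + k then (if k = 0 then (1 : ℝ) else 0) else 0)
          = (if k = 0 then (if j + 1 ≤ i then (1 : ℝ) else 0) else 0) := by
        intro k
        by_cases hk : k = 0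
        · subst hk; simp
        · simp [hk]
      rw [← Finset.mul_sum, Finset.sum_congr rfl (fun k _ => e4 k), Finset.sum_ite_eq' (Finset.range (M₂ + 1)) 0,
        if_pos (Finset.mem_range.2 (Nat.succ_pos M₂))]
      ring
  rw [Finset.mul_sum, Finset.sum_congr rfl hrow, Finset.sum_sub_distrib]
  congr 1
  · rw [Finset.sum_comm]
    refine Finset.sum_congr rfl fun r _ => ?_
    symm
    rw [Finset.mul_sum, Finset.mul_sum, ← Finset.sum_add_distrib, Finset.mul_sum]
    exact Finset.sum_congr rfl fun i _ => by ring
  · rw [← Finset.mul_sum]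

/-- `Σ_{j < h ≤ M₁+M₂} gate (lconv μ₁ μ₂) q h ≥ q·μ₁{> j}` (`q ≥ 0`, `μ₁, μ₂ ≥ 0`, `μ₂` of mass `1`). [this work] -/
theorem gateConv_tail_ge_theta (M₁ M₂ j : ℕ) (μ₁ μ₂ : ℕ → ℝ) (q : ℝ) (hq0 : 0 ≤ q) (h10 : ∀ h, 0 ≤ μ₁ h) (h20 : ∀ h, 0 ≤ μ₂ h)
    (h21 : ∑ h ∈ Finset.range (M₂ + 1), μ₂ h = 1) :
    q * ∑ i ∈ Finset.range (M₁ + 1), μ₁ i * (if j + 1 ≤ i then (1 : ℝ) else 0)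
      ≤ ∑ h ∈ Finset.Ico (j + 1) (M₁ + M₂ + 1), gate (lconv M₁ M₂ μ₁ μ₂) q h := by
  have hgate : ∀ h ∈ Finset.Ico (j + 1) (M₁ + M₂ + 1), gate (lconv M₁ M₂ μ₁ μ₂) q h = q * lconv M₁ M₂ μ₁ μ₂ h := by
    intro h hh
    rw [gate_apply, if_neg (by have := (Finset.mem_Ico.1 hh).1; omega)]; ring
  rw [Finset.sum_congr rfl hgate, ← Finset.mul_sum, conv_tail_eq]
  refine mul_le_mul_of_nonneg_left (Finset.sum_le_sum fun i _ => ?_) hq0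
  by_cases hij : j + 1 ≤ i
  · have e : ∑ k ∈ Finset.range (M₂ + 1), (if j + 1 ≤ i + k then μ₁ i * μ₂ k else 0) = μ₁ i := by
      rw [Finset.sum_congr rfl (fun k _ => if_pos (by omega : j + 1 ≤ i + k)), ← Finset.mul_sum, h21, mul_one]
    rw [if_pos hij, mul_one, e]
  · rw [if_neg hij, mul_zero]
    exact Finset.sum_nonneg fun k _ => by split_ifs; exacts [mul_nonneg (h10 i) (h20 k), le_rfl]

/-! ### One heavy gated factor suffices at the dominant layers -/

/-- **`SingleGateConvClosed` AT A DOMINANT LAYER, ONE HEAVY FACTOR**: `gate μ₁ q` top-affordable and DEC(j′) at every `j′ < M₁` (any data),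
`gate μ₂ q` with a heavy datum at layer `j` (target `q·T₂`), `2j < q(T₁ + T₂)` ⟹ `y ≤ Σ_{j < h ≤ M₁+M₂} gate (lconv μ₁ μ₂) q h`. [this work] -/
theorem gateConv_tail_ge_of_hdecAtT (y q T₁ T₂ : ℝ) (j M₁ M₂ : ℕ) (μ₁ μ₂ : ℕ → ℝ)
    (hy0 : 0 < y) (hy1 : y < 1) (hyq : y ≤ q) (hq1 : q ≤ 1)
    (h10 : ∀ h, 0 ≤ μ₁ h) (h1M : ∀ h, M₁ < h → μ₁ h = 0) (h11 : ∑ h ∈ Finset.range (M₁ + 1), μ₁ h = 1)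
    (hT₁ : ∑ h ∈ Finset.range (M₁ + 1), (h : ℝ) * μ₁ h = T₁) (hta : y * (M₁ : ℝ) ≤ q * T₁)
    (hdec : ∀ j', j' < M₁ → DECAt y j' M₁ (gate μ₁ q))
    (h20 : ∀ h, 0 ≤ μ₂ h) (h21 : ∑ h ∈ Finset.range (M₂ + 1), μ₂ h = 1)
    (h2 : HDECAtT y (q * T₂) j M₂ (gate μ₂ q)) (hdom : 2 * (j : ℝ) < q * (T₁ + T₂)) :
    y ≤ ∑ h ∈ Finset.Ico (j + 1) (M₁ + M₂ + 1), gate (lconv M₁ M₂ μ₁ μ₂) q h := by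
  classical
  have hq0 : 0 < q := hy0.trans_le hyq
  obtain ⟨ρ, hρ, lam, g, lo, hi, hl0, hl1, hg, hlohi, hhi, hν₂, hval⟩ := h2
  -- the gated first factor `ν₁`
  obtain ⟨hν0, hνM, hν1⟩ := gate_laws M₁ μ₁ q hq0.le hq1 h10 h1M h11
  have hνT : ∑ h ∈ Finset.range (M₁ + 1), (h : ℝ) * gate μ₁ q h = q * T₁ := by rw [sum_mul_gate, hT₁]
  -- bare tails `Ψ`, gated tails, and `θ = ν₁{> j}`
  set Ψ : ℕ → ℝ := fun s => ∑ i ∈ Finset.range (M₁ + 1), μ₁ i * (if j + 1 ≤ i + s then (1 : ℝ) else 0) with hΨ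
  set θ : ℝ := ∑ i ∈ Finset.range (M₁ + 1), (if j + 1 ≤ i then gate μ₁ q i else 0) with hθ
  have hΨ0 : ∀ s, 0 ≤ Ψ s := fun s => Finset.sum_nonneg fun i _ => mul_nonneg (h10 i) (by split_ifs <;> norm_num)
  have hΨ1 : ∀ s, j + 1 ≤ s → Ψ s = 1 := by
    intro s hs
    show ∑ i ∈ Finset.range (M₁ + 1), μ₁ i * (if j + 1 ≤ i + s then (1 : ℝ) else 0) = 1
    have e : ∀ i ∈ Finset.range (M₁ + 1), μ₁ i * (if j + 1 ≤ i + s then (1 : ℝ) else 0) = μ₁ i :=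
      fun i _ => by rw [if_pos (by omega), mul_one]
    rw [Finset.sum_congr rfl e, h11]
  -- for `s ≤ j` the atoms counted are `≥ 1`, where `gate μ₁ q = q·μ₁`
  have hΨgate : ∀ s, s ≤ j → q * Ψ s = ∑ i ∈ Finset.range (M₁ + 1), (if (j - s) + 1 ≤ i then gate μ₁ q i else 0) := by
    intro s hs
    show q * ∑ i ∈ Finset.range (M₁ + 1), μ₁ i * (if j + 1 ≤ i + s then (1 : ℝ) else 0) = _
    rw [Finset.mul_sum]
    refine Finset.sum_congr rfl fun i _ => ?_
    by_cases h1 : j + 1 ≤ i + s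
    · rw [if_pos h1, if_pos (by omega), gate_apply, if_neg (by omega)]; ring
    · rw [if_neg h1, if_neg (by omega)]; ring
  have hθΨ : q * Ψ 0 = θ := by rw [hΨgate 0 (Nat.zero_le j), Nat.sub_zero]
  have hθ0 : 0 ≤ θ := Finset.sum_nonneg fun i _ => by split_ifs; exacts [hν0 i, le_rfl]
  -- monotonicity: `q·Ψ(s) ≥ θ` for `s ≤ j`
  have hΨθ : ∀ s, s ≤ j → θ ≤ q * Ψ s := by
    intro s hs
    rw [hΨgate s hs, hθ]
    have := sum_gt_antitone M₁ j (j - s) (gate μ₁ q) hν0 (Nat.sub_le j s)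
    exact this
  -- the row of `ν₁` at a dominant layer: `q·Ψ(s) ≥ y` when `2(j − s) < q·T₁`
  have hΨrow : ∀ s, s ≤ j → 2 * ((j : ℝ) - s) < q * T₁ → y ≤ q * Ψ s := by
    intro s hs hdom'
    rw [hΨgate s hs]
    refine tail_ge_of_decAt_all y (q * T₁) M₁ (j - s) (gate μ₁ q) hy0 hy1 hν0 hνM hν1 hνT hta hdec ?_
    rw [Nat.cast_sub hs]; exact hdom'
  -- the heavy credit pair bound: `q·((1−g)Ψ(lo) + gΨ(hi)) ≥ y` for `lo < hi ≤ j`, `g ≥ y`, `qT₂ ≤ 2lo + (hi−lo)g`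
  have hN : ∀ (a b : ℕ) (γ : ℝ), a < b → b ≤ j → y ≤ γ → γ ≤ 1 → q * T₂ ≤ 2 * (a : ℝ) + ((b : ℝ) - a) * γ →
      y ≤ q * ((1 - γ) * Ψ a + γ * Ψ b) := by
    intro a b γ hab hbj hyγ hγ1 hcr
    have haj : a ≤ j := hab.le.trans hbj
    set τ : ℝ := ∑ i ∈ Finset.range (M₁ + 1), (if (j - a) + 1 ≤ i then gate μ₁ q i else 0) with hτ
    set u : ℝ := ∑ i ∈ Finset.range (M₁ + 1), (if i ≤ j - b then gate μ₁ q i else 0) with hu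
    have ea : q * Ψ a = τ := hΨgate a haj
    have eb : q * Ψ b = 1 - u := by
      rw [hΨgate b hbj]
      have hs := sum_le_add_sum_gt M₁ (j - b) (gate μ₁ q)
      rw [hν1] at hs
      linarith
    have hii : j - b ≤ j - a := by omega
    have hdeep : ((j - a : ℕ) : ℝ) + ((j - b : ℕ) : ℝ) < q * T₁ := by
      rw [Nat.cast_sub haj, Nat.cast_sub hbj]
      have hd : (0 : ℝ) ≤ (b : ℝ) - a := by
        have : (a : ℝ) ≤ b := by exact_mod_cast hab.le
        linarith
      have hm := mul_le_mul_of_nonneg_left hγ1 hd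
      linarith
    have hgb := deepLows_le_giants y (q * T₁) M₁ (j - a) (j - b) (gate μ₁ q) hy0 hy1 hν0 hνM hν1 hνT hta hdec hii hdeep
    have hτu : τ ≤ 1 - u := by
      have hmono := sum_gt_antitone M₁ (j - a) (j - b) (gate μ₁ q) hν0 hii
      have hs := sum_le_add_sum_gt M₁ (j - b) (gate μ₁ q)
      rw [hν1] at hs
      rw [hτ, hu]; linarith
    rw [← hτ, ← hu] at hgb
    have e : q * ((1 - γ) * Ψ a + γ * Ψ b) = (1 - γ) * (q * Ψ a) + γ * (q * Ψ b) := by ring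
    rw [e, ea, eb]
    have h1 : y * (1 - u - τ) ≤ γ * (1 - u - τ) := mul_le_mul_of_nonneg_right hyγ (by linarith)
    linarith
  -- every charged component: `W ≥ y + u + v·θ/q` with `u, v ≥ 0`, `u + v·y/q ≥ (1−q)y/q`
  have hyq' : (1 - q) * y / q = y / q - y := by field_simp
  have hyqy : y ≤ y / q := by rw [le_div_iff₀ hq0]; nlinarith
  have hyq1 : y / q ≤ 1 := by rw [div_le_one hq0]; exact hyq
  have hcomp : ∀ r, ∃ u v : ℝ, 0 ≤ u ∧ 0 ≤ v ∧ (1 - q) * y / q ≤ u + v * y / q ∧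
      (0 < lam r → y + u + v * θ / q ≤ g r * Ψ (hi r) + (1 - g r) * Ψ (lo r)) := by
    intro r
    by_cases hr : 0 < lam r
    swap
    · refine ⟨y / q - y, 0, by linarith, le_rfl, ?_, fun h => absurd h hr⟩
      rw [hyq', zero_mul, zero_div, add_zero]
    rcases hval r hr with ⟨heq, hS⟩ | ⟨hlt, hgi, hyg⟩ | ⟨hlt, hhij, hyg, hcr⟩
    · -- (S) a point `b = lo = hi`
      have eW : g r * Ψ (hi r) + (1 - g r) * Ψ (lo r) = Ψ (lo r) := by rw [← heq]; ring
      by_cases hbj : j + 1 ≤ lo r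
      · refine ⟨1 - y, 0, by linarith, le_rfl, ?_, fun _ => ?_⟩
        · rw [hyq', zero_mul, zero_div, add_zero]; linarith
        · rw [eW, hΨ1 _ hbj, zero_mul, zero_div, add_zero]; linarith
      · have hbj' : lo r ≤ j := by omega
        have h2b : q * T₂ ≤ 2 * (lo r : ℝ) := by
          rcases hS with h | h
          · exact h
          · exact absurd h hbj
        refine ⟨y / q - y, 0, by linarith, le_rfl, ?_, fun _ => ?_⟩
        · rw [hyq', zero_mul, zero_div, add_zero]
        · rw [eW, zero_mul, zero_div, add_zero]
          have hrow := hΨrow (lo r) hbj' (by linarith)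
          have hq' : y / q ≤ Ψ (lo r) := by rw [div_le_iff₀ hq0]; linarith
          linarith
    · -- (G) a giant pair `hi ≥ j+1`, `g ≥ y`
      rw [hΨ1 _ hgi, mul_one]
      by_cases hloj : j + 1 ≤ lo r
      · refine ⟨1 - y, 0, by linarith, le_rfl, ?_, fun _ => ?_⟩
        · rw [hyq', zero_mul, zero_div, add_zero]; linarith
        · rw [hΨ1 _ hloj, zero_mul, zero_div, add_zero]; linarith
      · have hloj' : lo r ≤ j := by omega
        by_cases hself : q * T₂ ≤ 2 * (lo r : ℝ)
        · -- `lo` self-sufficient: `Ψ(lo) ≥ y/q`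
          have hu0 : 0 ≤ (1 - g r) * (y / q - y) + g r * (1 - y) :=
            add_nonneg (mul_nonneg (by linarith [(hg r).2]) (by linarith)) (mul_nonneg (hg r).1 (by linarith))
          refine ⟨(1 - g r) * (y / q - y) + g r * (1 - y), 0, hu0, le_rfl, ?_, fun _ => ?_⟩
          · rw [hyq', zero_mul, zero_div, add_zero]
            have e : (1 - g r) * (y / q - y) + g r * (1 - y) - (y / q - y) = g r * (1 - y / q) := by ring
            have h2 : 0 ≤ g r * (1 - y / q) := mul_nonneg (hg r).1 (by linarith)
            linarith
          · have hrow := hΨrow (lo r) hloj' (by linarith)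
            have hq' : y / q ≤ Ψ (lo r) := by rw [div_le_iff₀ hq0]; linarith
            have h3 : 0 ≤ (1 - g r) * (Ψ (lo r) - y / q) := mul_nonneg (by linarith [(hg r).2]) (by linarith)
            have e : g r + (1 - g r) * Ψ (lo r) - (y + ((1 - g r) * (y / q - y) + g r * (1 - y)) + 0 * θ / q)
                = (1 - g r) * (Ψ (lo r) - y / q) := by ring
            linarith
        · -- `lo` a low: `Ψ(lo) ≥ θ/q`
          refine ⟨g r - y, 1 - g r, by linarith, by linarith [(hg r).2], ?_, fun _ => ?_⟩
          · rw [hyq']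
            have e : g r - y + (1 - g r) * y / q - (y / q - y) = g r * (1 - y / q) := by ring
            have h2 : 0 ≤ g r * (1 - y / q) := mul_nonneg (hg r).1 (by linarith)
            linarith
          · have hm := hΨθ (lo r) hloj'
            have hq' : θ / q ≤ Ψ (lo r) := by rw [div_le_iff₀ hq0]; linarith
            have h3 : 0 ≤ (1 - g r) * (Ψ (lo r) - θ / q) := mul_nonneg (by linarith [(hg r).2]) (by linarith)
            have e : g r + (1 - g r) * Ψ (lo r) - (y + (g r - y) + (1 - g r) * θ / q) = (1 - g r) * (Ψ (lo r) - θ / q) := by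
              ring
            linarith
    · -- (N) a heavy credit pair: worth `≥ y/q`
      refine ⟨y / q - y, 0, by linarith, le_rfl, ?_, fun _ => ?_⟩
      · rw [hyq', zero_mul, zero_div, add_zero]
      · have hb := hN (lo r) (hi r) (g r) hlt hhij hyg (hg r).2 hcr
        have hq' : y / q ≤ (1 - g r) * Ψ (lo r) + g r * Ψ (hi r) := by rw [div_le_iff₀ hq0]; linarith
        rw [zero_mul, zero_div, add_zero]
        linarith
  choose u v hu0 hv0 huv hW using hcomp
  -- the tail identity and the direct bound
  have esum : ∑ i ∈ Finset.range (M₁ + 1), μ₁ i * (if j + 1 ≤ i then (1 : ℝ) else 0) = θ / q := by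
    have e0 : Ψ 0 = ∑ i ∈ Finset.range (M₁ + 1), μ₁ i * (if j + 1 ≤ i then (1 : ℝ) else 0) := by
      show ∑ i ∈ Finset.range (M₁ + 1), μ₁ i * (if j + 1 ≤ i + 0 then (1 : ℝ) else 0) = _
      simp only [Nat.add_zero]
    rw [← e0, ← hθΨ]
    field_simp
  have htail := gateConv_tail_eq_pieces M₁ M₂ j μ₁ μ₂ q lam g lo hi hlohi hhi hν₂
  rw [esum] at htail
  have hdirect : θ ≤ ∑ h ∈ Finset.Ico (j + 1) (M₁ + M₂ + 1), gate (lconv M₁ M₂ μ₁ μ₂) q h := by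
    have h := gateConv_tail_ge_theta M₁ M₂ j μ₁ μ₂ q hq0.le h10 h20 h21
    rw [esum, show q * (θ / q) = θ by field_simp] at h
    exact h
  -- sum of the piece bounds
  set U : ℝ := ∑ r, lam r * u r with hUdef
  set V : ℝ := ∑ r, lam r * v r with hVdef
  set S : ℝ := ∑ r, lam r * (g r * Ψ (hi r) + (1 - g r) * Ψ (lo r)) with hSdef
  have hsum : y + U + V * θ / q ≤ S := by
    have e : y + U + V * θ / q = ∑ r, lam r * (y + u r + v r * θ / q) := by
      rw [hUdef, hVdef]
      calc y + ∑ r, lam r * u r + (∑ r, lam r * v r) * θ / q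
          = (∑ r, lam r) * y + ∑ r, lam r * u r + (∑ r, lam r * v r) * θ / q := by rw [hl1, one_mul]
        _ = ∑ r, lam r * (y + u r + v r * θ / q) := by
          rw [Finset.sum_mul, Finset.sum_mul, Finset.sum_div, ← Finset.sum_add_distrib, ← Finset.sum_add_distrib]
          exact Finset.sum_congr rfl fun r _ => by ring
    rw [e, hSdef]
    refine Finset.sum_le_sum fun r _ => ?_
    rcases (hl0 r).eq_or_lt with hz | hpos
    · rw [← hz, zero_mul, zero_mul]
    · exact mul_le_mul_of_nonneg_left (hW r hpos) (hl0 r)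
  have hU : 0 ≤ U := Finset.sum_nonneg fun r _ => mul_nonneg (hl0 r) (hu0 r)
  have hUV : (1 - q) * y / q ≤ U + V * y / q := by
    have e : U + V * y / q = ∑ r, lam r * (u r + v r * y / q) := by
      rw [hUdef, hVdef, Finset.sum_mul, Finset.sum_div, ← Finset.sum_add_distrib]
      exact Finset.sum_congr rfl fun r _ => by ring
    have e2 : (1 - q) * y / q = ∑ r, lam r * ((1 - q) * y / q) := by rw [← Finset.sum_mul, hl1, one_mul]
    rw [e, e2]
    exact Finset.sum_le_sum fun r _ => mul_le_mul_of_nonneg_left (huv r) (hl0 r)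
  rw [htail]
  show y ≤ S - (1 - q) * (θ / q)
  by_cases hθy : y ≤ θ
  · rw [htail] at hdirect
    exact hθy.trans hdirect
  · have hθy' : θ ≤ y := le_of_lt (not_le.1 hθy)
    have e1 : V * θ / q - (1 - q) * (θ / q) = (V - (1 - q)) * (θ / q) := by ring
    by_cases hVq : 1 - q ≤ V
    · have h1 : 0 ≤ (V - (1 - q)) * (θ / q) := mul_nonneg (by linarith) (div_nonneg hθ0 hq0.le)
      linarith
    · -- `V < 1 − q`: affine in `θ`, nonpositive slope: evaluate at `θ = y`
      have hslope : (V - (1 - q)) * (y / q) ≤ (V - (1 - q)) * (θ / q) :=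
        mul_le_mul_of_nonpos_left (div_le_div_of_nonneg_right hθy' hq0.le) (by linarith)
      have e2 : U + (V - (1 - q)) * (y / q) = (U + V * y / q) - (1 - q) * y / q := by ring
      linarith

/-- **the conclusion of `SingleGateConvClosed` at a dominant layer, one heavy factor** (`decAt_of_tail_ge` + `gateConv_tail_ge_of_hdecAtT`). [this work] -/
theorem gateConv_decAt_of_hdecAtT_dominant (y q T₁ T₂ : ℝ) (j M₁ M₂ : ℕ) (μ₁ μ₂ : ℕ → ℝ)
    (hy0 : 0 < y) (hy1 : y < 1) (hyq : y ≤ q) (hq1 : q ≤ 1)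
    (h10 : ∀ h, 0 ≤ μ₁ h) (h1M : ∀ h, M₁ < h → μ₁ h = 0) (h11 : ∑ h ∈ Finset.range (M₁ + 1), μ₁ h = 1)
    (hT₁ : ∑ h ∈ Finset.range (M₁ + 1), (h : ℝ) * μ₁ h = T₁) (hta : y * (M₁ : ℝ) ≤ q * T₁)
    (hdec : ∀ j', j' < M₁ → DECAt y j' M₁ (gate μ₁ q))
    (h20 : ∀ h, 0 ≤ μ₂ h) (h21 : ∑ h ∈ Finset.range (M₂ + 1), μ₂ h = 1)
    (h2 : HDECAtT y (q * T₂) j M₂ (gate μ₂ q)) (hdom : 2 * (j : ℝ) < q * (T₁ + T₂)) :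
    DECAt y j (M₁ + M₂) (gate (lconv M₁ M₂ μ₁ μ₂) q) := by
  have hq0 : 0 < q := hy0.trans_le hyq
  obtain ⟨hP0, hPM, hP1⟩ := gate_laws (M₁ + M₂) (lconv M₁ M₂ μ₁ μ₂) q hq0.le hq1 (lconv_nonneg M₁ M₂ μ₁ μ₂ h10 h20)
    (fun h hh => lconv_eq_zero M₁ M₂ μ₁ μ₂ h hh) (sum_lconv M₁ M₂ μ₁ μ₂ h11 h21)
  exact decAt_of_tail_ge (M₁ + M₂) _ hP0 hPM hP1 y j hy0
    (gateConv_tail_ge_of_hdecAtT y q T₁ T₂ j M₁ M₂ μ₁ μ₂ hy0 hy1 hyq hq1 h10 h1M h11 hT₁ hta hdec h20 h21 h2 hdom)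

/-- **both gated factors HEAVY-DEC at every layer below their tops ⟹ `gate_q(μ₁ ∗ μ₂)` is `DECAt y j (M₁+M₂)` at every layer with
`2j < q(T₁ + T₂)`** (the layer picks the factor: `j < M₂`, else `j < M₁`). [this work] -/
theorem gateConv_decAt_dominant_of_hdec (y q T₁ T₂ : ℝ) (j M₁ M₂ : ℕ) (μ₁ μ₂ : ℕ → ℝ)
    (hy0 : 0 < y) (hy1 : y < 1) (hyq : y ≤ q) (hq1 : q ≤ 1)
    (h10 : ∀ h, 0 ≤ μ₁ h) (h1M : ∀ h, M₁ < h → μ₁ h = 0) (h11 : ∑ h ∈ Finset.range (M₁ + 1), μ₁ h = 1)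
    (hT₁ : ∑ h ∈ Finset.range (M₁ + 1), (h : ℝ) * μ₁ h = T₁) (hta1 : y * (M₁ : ℝ) ≤ q * T₁)
    (hH1 : ∀ j', j' < M₁ → HDECAtT y (q * T₁) j' M₁ (gate μ₁ q))
    (h20 : ∀ h, 0 ≤ μ₂ h) (h2M : ∀ h, M₂ < h → μ₂ h = 0) (h21 : ∑ h ∈ Finset.range (M₂ + 1), μ₂ h = 1)
    (hT₂ : ∑ h ∈ Finset.range (M₂ + 1), (h : ℝ) * μ₂ h = T₂) (hta2 : y * (M₂ : ℝ) ≤ q * T₂)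
    (hH2 : ∀ j', j' < M₂ → HDECAtT y (q * T₂) j' M₂ (gate μ₂ q)) (hdom : 2 * (j : ℝ) < q * (T₁ + T₂)) :
    DECAt y j (M₁ + M₂) (gate (lconv M₁ M₂ μ₁ μ₂) q) := by
  have hq0 : 0 < q := hy0.trans_le hyq
  have hdec1 : ∀ j', j' < M₁ → DECAt y j' M₁ (gate μ₁ q) := fun j' hj' => by
    rw [decAt_iff_decAtT, sum_mul_gate, hT₁]; exact (hH1 j' hj').decAtT
  have hdec2 : ∀ j', j' < M₂ → DECAt y j' M₂ (gate μ₂ q) := fun j' hj' => by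
    rw [decAt_iff_decAtT, sum_mul_gate, hT₂]; exact (hH2 j' hj').decAtT
  by_cases hj2 : j < M₂
  · exact gateConv_decAt_of_hdecAtT_dominant y q T₁ T₂ j M₁ M₂ μ₁ μ₂ hy0 hy1 hyq hq1 h10 h1M h11 hT₁ hta1 hdec1 h20 h21
      (hH2 j hj2) hdom
  · have hj1 : j < M₁ := by
      by_contra hc
      have hm1 := lawMean_le_top M₁ μ₁ h10 h11
      have hm2 := lawMean_le_top M₂ μ₂ h20 h21
      rw [hT₁] at hm1; rw [hT₂] at hm2
      have e1 : (M₂ : ℝ) ≤ j := by exact_mod_cast not_lt.1 hj2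
      have e2 : (M₁ : ℝ) ≤ j := by exact_mod_cast not_lt.1 hc
      have : q * (T₁ + T₂) ≤ T₁ + T₂ := by nlinarith
      linarith
    rw [lconv_comm, Nat.add_comm]
    exact gateConv_decAt_of_hdecAtT_dominant y q T₂ T₁ j M₂ M₁ μ₂ μ₁ hy0 hy1 hyq hq1 h20 h2M h21 hT₂ hta2 hdec2 h10 h11
      (hH1 j hj1) (by linarith)

end LawDec

end Quant

end Summit.CriticalPhenomena.PercolationContinuityZ3.Theorems
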